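import Literature.Computability.AlgebraicComplexity.BorderRankMatMulRectangularProofs
import Literature.Computability.AlgebraicComplexity.LandsbergRyderGluing
import Literature.Computability.AlgebraicComplexity.BorderRankMatMulTwoHolds
import Literature.Computability.AlgebraicComplexity.BorderRankRestriction
import HarnessLib

/-!
# Border rank of the BCLR(S) tensors: `bR(T_{BCLR}) = 5` and `bR(T_{BCLRS,m}) ≥ 3m − 2` — proved
(discharge of `LandsbergRyder2017_prop_3_2`)

Topic `Literature/Computability/AlgebraicComplexity`; sibling of `BorderRankMatMulRectangular.lean`,
whose named fact `LandsbergRyder2017_prop_3_2` — J. M. Landsberg, N. Ryder, *On the geometry of border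
rank algorithms for `n × 2` by `2 × 2` matrix multiplication*, Exp. Math. 26 (2017) = arXiv:1509.08323,
**Prop. 3.2: "`R̲(T_{BCLR}) = 5` and for `m > 2`, `R̲(T_{BCLRS,m}) ≥ 3m − 2`"** (held text p. 5; there
"for the lower bounds we use Strassen's equations") — is DISCHARGED here, `T_{BCLRS,m}` being rendered
as in the fact: `M_⟨m,2,2⟩` with the `A`-coordinate `(0,0)` killed,
`fun c a b => if a = (0,0) then 0 else matMulTensor ℂ m 2 2 c a b`
(`T_{BCLRS,m} = M_⟨m,2,2⟩ − x¹₁ ⊗ (y¹₁ ⊗ z¹₁ + y¹₂ ⊗ z²₁)`, §2 of the source).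

Proof given here (a different, shorter route than the source's commutator computation, using what
the tree has already proved):

* **Lower bounds by sub-additivity of border rank.** The killed piece
  `P_m := x¹₁ ⊗ (y¹₁ ⊗ z¹₁ + y¹₂ ⊗ z²₁)` (`fun c a b => if a = (0,0) then matMulTensor … else 0`) has
  rank `≤ 2`, and `T_{BCLRS,m} + P_m = M_⟨m,2,2⟩`, so `bR(M_⟨m,2,2⟩) ≤ bR(T_{BCLRS,m}) + 2`
  (`algBorderRank_add_le`, Landsberg–Ryder gluing file).  With the tree's Koszul-flattening floor
  `3m ≤ bR(M_⟨m,2,2⟩)` (`three_mul_le_algBorderRank_matMulTensor_n22`, characteristic `0`; the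
  source's "Strassen's equations imply `R̲(M_⟨n,2,2⟩) ≥ 3n`", p. 5) this is `bR(T_{BCLRS,m}) ≥ 3m − 2`
  for EVERY `m ≥ 1`; with Landsberg's `bR(M_⟨2,2,2⟩) = 7` (tree theorem
  `MatMulTwo.seven_le_algBorderRank_matMulTensor_two`, torus-fixed border apolarity) it is
  `bR(T_{BCLR}) ≥ 5`.
* **Upper bound `bR(T_{BCLR}) ≤ 5`** — Bini–Capovani–Lotti–Romani 1979 ("the upper bound for `T_{BCLR}`
  comes from [BCLR79]", p. 5): the tree's kernel-checked five-product approximate algorithm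
  `BCS1997_algBorderRank_partialMatMul_222_le_five` for `□ × □` (the `(1,1)` corner of the first factor
  zero, BCS 1997 §15.2) transported to the `(0,0)` corner by reversing the row index of `A`/`C` and the
  inner index (`algBorderRank_precomp_le`).

Everything is proved; no definitions, no named facts.

## References

* [LandsbergRyder2015] J. M. Landsberg, N. Ryder, Exp. Math. 26 (2017) 275–286 = arXiv:1509.08323,
  §2 (definition of `T_{BCLRS,m}`), Prop. 3.2 (p. 5).
* [BiniEtAl1979] D. Bini, M. Capovani, F. Romani, G. Lotti, Inform. Process. Lett. 8 (1979) 234–235.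
* [BurgisserClausenShokrollahi1997] §15.2 (`□ × □ ⊴₂ ⟨5⟩`).
* [Landsberg2005] J. M. Landsberg, J. Amer. Math. Soc. 19 (2006) 447–459 (`R̲(M_⟨2⟩) = 7`).
-/

noncomputable section

open scoped BigOperators

namespace Literature.Computability.AlgebraicComplexity

namespace LandsbergRyderBCLR

/-- `T_{BCLRS,m} + P_m = M_⟨m,2,2⟩` (the killed piece added back). [cite: LandsbergRyder2015, §2] -/
theorem bclrs_add_piece (m : ℕ) (hm : 0 < m) :
    ((fun (c : Fin m × Fin 2) (a : Fin m × Fin 2) (b : Fin 2 × Fin 2) =>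
        if a = (⟨0, hm⟩, 0) then (0 : ℂ) else matMulTensor ℂ m 2 2 c a b) +
      fun (c : Fin m × Fin 2) (a : Fin m × Fin 2) (b : Fin 2 × Fin 2) =>
        if a = (⟨0, hm⟩, 0) then matMulTensor ℂ m 2 2 c a b else 0) = matMulTensor ℂ m 2 2 := by
  funext c a b
  simp only [Pi.add_apply]
  split_ifs <;> simp

/-- The killed piece `P_m = x¹₁ ⊗ (y¹₁ ⊗ z¹₁ + y¹₂ ⊗ z²₁)` is the sum of the two triads
`z_{0j} ⊗ x_{00} ⊗ y_{0j}`, `j = 0, 1`. [cite: LandsbergRyder2015, §2] -/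
theorem piece_eq_sum (m : ℕ) (hm : 0 < m) :
    (fun (c : Fin m × Fin 2) (a : Fin m × Fin 2) (b : Fin 2 × Fin 2) =>
        if a = (⟨0, hm⟩, 0) then matMulTensor ℂ m 2 2 c a b else 0) =
      ∑ j : Fin 2, triad (fun c : Fin m × Fin 2 => if c = (⟨0, hm⟩, j) then (1 : ℂ) else 0)
        (fun a : Fin m × Fin 2 => if a = (⟨0, hm⟩, 0) then (1 : ℂ) else 0)
        (fun b : Fin 2 × Fin 2 => if b = (0, j) then (1 : ℂ) else 0) := by
  funext c a b
  obtain ⟨i, l⟩ := c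
  obtain ⟨i', k⟩ := a
  obtain ⟨k', l'⟩ := b
  simp only [matMulTensor, Finset.sum_apply, triad_apply, Fin.sum_univ_two, Prod.mk.injEq]
  by_cases h1 : i' = ⟨0, hm⟩ <;> by_cases h3 : i = ⟨0, hm⟩ <;> fin_cases k <;> fin_cases k' <;>
    fin_cases l <;> fin_cases l' <;> simp_all

/-- `bR(P_m) ≤ R(P_m) ≤ 2`. [cite: LandsbergRyder2015, §2] -/
theorem algBorderRank_piece_le (m : ℕ) (hm : 0 < m) :
    algBorderRank (fun (c : Fin m × Fin 2) (a : Fin m × Fin 2) (b : Fin 2 × Fin 2) =>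
        if a = (⟨0, hm⟩, 0) then matMulTensor ℂ m 2 2 c a b else 0) ≤ 2 :=
  (algBorderRank_le_tensorRank _).trans
    ((tensorRank_le_of_eq_sum _ _ _ (piece_eq_sum m hm)).trans (by simp))

/-- **`bR(M_⟨m,2,2⟩) ≤ bR(T_{BCLRS,m}) + 2`** (sub-additivity of border rank,
`algBorderRank_add_le`). [cite: LandsbergRyder2015, Prop. 3.2 (proof ingredient)] -/
theorem algBorderRank_matMulTensor_le_bclrs_add_two (m : ℕ) (hm : 0 < m) :
    algBorderRank (matMulTensor ℂ m 2 2) ≤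
      algBorderRank (fun (c : Fin m × Fin 2) (a : Fin m × Fin 2) (b : Fin 2 × Fin 2) =>
        if a = (⟨0, hm⟩, 0) then (0 : ℂ) else matMulTensor ℂ m 2 2 c a b) + 2 := by
  have h := algBorderRank_add_le
    (fun (c : Fin m × Fin 2) (a : Fin m × Fin 2) (b : Fin 2 × Fin 2) =>
      if a = (⟨0, hm⟩, 0) then (0 : ℂ) else matMulTensor ℂ m 2 2 c a b)
    (fun (c : Fin m × Fin 2) (a : Fin m × Fin 2) (b : Fin 2 × Fin 2) =>
      if a = (⟨0, hm⟩, 0) then matMulTensor ℂ m 2 2 c a b else 0)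
  rw [bclrs_add_piece m hm] at h
  exact h.trans (Nat.add_le_add_left (algBorderRank_piece_le m hm) _)

/-- **`bR(T_{BCLRS,m}) ≥ 3m − 2` for every `m ≥ 1`** (the source states it for `m > 2`; for `m = 2`
the sharper `5` holds, below): `3m ≤ bR(M_⟨m,2,2⟩) ≤ bR(T_{BCLRS,m}) + 2`.
[cite: LandsbergRyder2015, Prop. 3.2 (p. 5)] -/
theorem three_mul_sub_two_le_algBorderRank_bclrs (m : ℕ) (hm : 0 < m) :
    3 * m - 2 ≤ algBorderRank (fun (c : Fin m × Fin 2) (a : Fin m × Fin 2) (b : Fin 2 × Fin 2) =>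
        if a = (⟨0, hm⟩, 0) then (0 : ℂ) else matMulTensor ℂ m 2 2 c a b) := by
  have h1 := three_mul_le_algBorderRank_matMulTensor_n22 ℂ m
  have h2 := algBorderRank_matMulTensor_le_bclrs_add_two m hm
  omega

/-- **`bR(T_{BCLR}) ≥ 5`**: `7 = bR(M_⟨2,2,2⟩) ≤ bR(T_{BCLR}) + 2` (Landsberg 2006, tree theorem
`MatMulTwo.seven_le_algBorderRank_matMulTensor_two`). [cite: LandsbergRyder2015, Prop. 3.2 (p. 5)] -/
theorem five_le_algBorderRank_bclr :
    5 ≤ algBorderRank (fun (c : Fin 2 × Fin 2) (a : Fin 2 × Fin 2) (b : Fin 2 × Fin 2) =>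
        if a = (0, 0) then (0 : ℂ) else matMulTensor ℂ 2 2 2 c a b) := by
  have h1 := MatMulTwo.seven_le_algBorderRank_matMulTensor_two ℂ
  have h2 := algBorderRank_matMulTensor_le_bclrs_add_two 2 two_pos
  have e : (fun (c : Fin 2 × Fin 2) (a : Fin 2 × Fin 2) (b : Fin 2 × Fin 2) =>
        if a = (⟨0, two_pos⟩, 0) then (0 : ℂ) else matMulTensor ℂ 2 2 2 c a b) =
      fun c a b => if a = (0, 0) then (0 : ℂ) else matMulTensor ℂ 2 2 2 c a b := rfl
  rw [e] at h2
  omega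

/-- `T_{BCLR}` (corner `(0,0)` of the first factor killed) is the BCS tensor `□ × □` (corner `(1,1)`
killed, `partialMatMulTensor … (univ.erase (1,1)) univ`) read off along the index reversal of the
row index of `A`/`C` and of the inner index. [cite: BurgisserClausenShokrollahi1997, §15.2 (□ × □)] -/
theorem bclr_eq_precomp_partialMatMul :
    (fun (c : Fin 2 × Fin 2) (a : Fin 2 × Fin 2) (b : Fin 2 × Fin 2) =>
        if a = (0, 0) then (0 : ℂ) else matMulTensor ℂ 2 2 2 c a b) = fun c a b =>
      partialMatMulTensor ℂ 2 2 2 (Finset.univ.erase (1, 1)) Finset.univ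
        (Fin.rev c.1, c.2) (Fin.rev a.1, Fin.rev a.2) (Fin.rev b.1, b.2) := by
  funext c a b
  obtain ⟨i, l⟩ := c
  obtain ⟨i', k⟩ := a
  obtain ⟨k', l'⟩ := b
  fin_cases i <;> fin_cases l <;> fin_cases i' <;> fin_cases k <;> fin_cases k' <;> fin_cases l' <;>
    simp [partialMatMulTensor, matMulTensor, Fin.rev]

/-- **`bR(T_{BCLR}) ≤ 5`** (Bini–Capovani–Lotti–Romani 1979; the tree's kernel-checked
`BCS1997_algBorderRank_partialMatMul_222_le_five`, transported by `algBorderRank_precomp_le`).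
[cite: BiniEtAl1979, main result] [cite: BurgisserClausenShokrollahi1997, §15.2] -/
theorem algBorderRank_bclr_le_five :
    algBorderRank (fun (c : Fin 2 × Fin 2) (a : Fin 2 × Fin 2) (b : Fin 2 × Fin 2) =>
        if a = (0, 0) then (0 : ℂ) else matMulTensor ℂ 2 2 2 c a b) ≤ 5 := by
  rw [bclr_eq_precomp_partialMatMul]
  exact (algBorderRank_precomp_le (partialMatMulTensor ℂ 2 2 2 (Finset.univ.erase (1, 1)) Finset.univ)
    (fun c : Fin 2 × Fin 2 => ((Fin.rev c.1, c.2) : Fin 2 × Fin 2))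
    (fun a : Fin 2 × Fin 2 => ((Fin.rev a.1, Fin.rev a.2) : Fin 2 × Fin 2))
    (fun b : Fin 2 × Fin 2 => ((Fin.rev b.1, b.2) : Fin 2 × Fin 2))).trans
    (BCS1997_algBorderRank_partialMatMul_222_le_five ℂ)

/-- **`bR(T_{BCLR}) = 5`.** [cite: LandsbergRyder2015, Prop. 3.2 (p. 5)] -/
theorem algBorderRank_bclr :
    algBorderRank (fun (c : Fin 2 × Fin 2) (a : Fin 2 × Fin 2) (b : Fin 2 × Fin 2) =>
        if a = (0, 0) then (0 : ℂ) else matMulTensor ℂ 2 2 2 c a b) = 5 :=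
  le_antisymm algBorderRank_bclr_le_five five_le_algBorderRank_bclr

end LandsbergRyderBCLR

/-- **Landsberg–Ryder 2017, Proposition 3.2 — DISCHARGE of the named fact
`LandsbergRyder2017_prop_3_2`**: `R̲(T_{BCLR}) = 5`, and `R̲(T_{BCLRS,m}) ≥ 3m − 2` for `m > 2`.
[cite: LandsbergRyder2015, Prop. 3.2 (p. 5)] -/
theorem LandsbergRyder2017_prop_3_2_holds : LandsbergRyder2017_prop_3_2 :=
  ⟨LandsbergRyderBCLR.algBorderRank_bclr,
    fun m hm => LandsbergRyderBCLR.three_mul_sub_two_le_algBorderRank_bclrs m (by omega)⟩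

end Literature.Computability.AlgebraicComplexity

end
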